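import Mathlib
import Literature.MathematicalPhysics.QuantumFieldTheory.Balaban1983to89.Beta.VolumeImages

/-!
# `Balaban1983to89.Beta.VolumeAffine` — volume rates under lattice TRANSLATIONS and the REFLECTION `x ↦ −x` on the torus
# `(ℤ/s)^d` (the window boundary layer), completing the calculus of `Beta/VolumeImages.lean` for one-loop bubbles

T. Bałaban, *Renormalization group approach to lattice gauge field theories. I. Generation of effective actions in a
small field approximation and a coupling constant renormalization in four dimensions*, Commun. Math. Phys. **109**,
249–301 (1987) [Balaban1987RG1] (cell paper B12; PDF page = journal page − 248; PDF held:
`paper:balaban1987-cmp109-rg-i-small-field`).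

HONEST FRAMING (cell rule, verbatim): discharging `BetaPertH` makes Bałaban's UV stability UNCONDITIONAL — a real
constructive-QFT result; it is NOT the continuum limit and NOT the Clay problem.  THIS MODULE ASSERTS NOTHING about the
series and nothing about β: every declaration is a kernel-checked theorem about ABSTRACT functions on `ℤ^d` and on the tori
`Site d (side t)`, over `Beta/InfiniteVolume.lean` (pv01 gen 3: `InWindow`, `windowMap`, `siteOf`), `Beta/InfiniteVolumeRate.lean`
(this unit: `VolumeRate`, `half_side_le_l1_of_not_window`) and `Beta/VolumeImages.lean` (this unit: `imageShift`,
`IsImageSum`, `ScalarVolumeRate`, the calculus `ScalarVolumeRate.add/.const_mul/.mul`), IMPORTED AND USED BY NAME.  Value =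
kernel lemmas behind a located gap (GAPS G-beta-4 / G-pv04-5 / G-pv04-7 (iii)), NOT summit progress.

WHAT THE PAPER PRINTS (CONTEXT ONLY; render `…1987-cmp109-rg-I-small-field-p016-x2.png` re-read by this unit).  p. 264, after
(1.21): "Now we take a limit of these functions as T^{(j+1)} ↗ Z^d. This limit exists by the localized representation (1.7)."
Print states existence and no rate.  `Beta/VolumeImages.lean` typed the METHOD OF IMAGES (`IsImageSum`: the torus function is
the sum of a `ℤ^d` function over the periodic images of the window representative) and proved that image sums of
(5.10)-decaying kernels have an EXPLICIT volume rate, plus closure of rates under sums, scalars and pointwise products; its header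
recorded (GAPS G-pv04-7 (ii)–(iii)) that a one-loop kernel contains terms BILINEAR in propagators, which on the torus are
products of TRANSLATED and REFLECTED image sums (local vertices: `Π(x) ∋ Σ_{a,b} c_{ab}·G(x + a)·G(−x + b)`), and that the
closure of rates under translation / reflection — where the window `]−s/2, s/2]^d` has a boundary layer — was still missing.
THIS MODULE supplies it:

* §1 RE-ANCHORING GEOMETRY (pure integers).  For a reference point `w` with `2|w_i| ≤ s`, a shift `a ∈ ℤ^d`, and the window
  representative `r = windowMap x'` of the class of `w + a` (so `w + a = r + s·m`): coordinatewise `|w_i| − |a_i| ≤ |r_i|`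
  (`abs_sub_abs_le_abs_rep`), hence `|w|₁ − |a|₁ ≤ |r|₁` (`l1_sub_l1_le_l1_windowMap`); and if `w + a` is OFF the window then
  `s/2 − |a|₁ ≤ |r|₁` (`half_side_sub_l1_le_l1_windowMap`) and `s/2 ≤ |w + a|₁` (InfiniteVolumeRate); if it is ON the window,
  `r = w + a`.  `siteOf` is additive and odd (`siteOf_add`, `siteOf_neg`).
* §2 THE RE-ANCHORING ESTIMATE `ScalarVolumeRate.reanchor`: under `ScalarVolumeRate side F Finf ρ δ` (`δ ≥ 0`) and
  `Decay510 Finf C δ₁` (`δ₁ ≥ 0`), for every exponent `δ′` with `δ′ ≤ δ`, `2δ′ ≤ δ₁`: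
  `|F t x' − Finf (w + a)| ≤ (ρ t·e^{δ|a|₁} + 2C·e^{δ₁|a|₁}·e^{−δ₁ s/4})·e^{−δ′|w|₁}` whenever `siteOf (w + a) = x'` and `2|w_i| ≤ s`.
* §3 CLOSURE THEOREMS: `ScalarVolumeRate.translate` (torus function `x ↦ F t (x + siteOf a)`, limit `y ↦ Finf (y + a)`, rate
  `ρ t·e^{δ|a|₁} + 2C·e^{δ₁|a|₁}·e^{−δ₁·side t/4}`, exponent `δ′`), `ScalarVolumeRate.reflect` (`x ↦ F t (−x)`, `y ↦ Finf (−y)`, rate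
  `ρ t + 2C·e^{−δ₁·side t/4}`, exponent `δ′`), the `μν`-indexed forms `VolumeRate.translate/.reflect`, the (5.10) transports
  `decay510_translate` (constant `C·e^{δ₁|a|₁}`) / `decay510_reflect`, and the EXACT (loss-free) structural forms
  `IsImageSum.translate` / `IsImageSum.reflect` (an image sum translated or reflected is again an image sum — representative
  independence, `VolumeImages.hasSum_imageShift_iff_of_siteOf_eq`).
* §4 THE BUBBLE SHAPE `ScalarVolumeRate.bubbleTerm`: the composite `x ↦ F₁ t (x + siteOf a) · F₂ t (−x + siteOf b)` converges to
  `y ↦ Finf₁ (y + a) · Finf₂ (−y + b)` at an explicit rate — translate, reflect, multiply (`VolumeImages.ScalarVolumeRate.mul`).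

So, with `Beta/VolumeImages.lean` §3–§4, EVERY finite expression `Σ c · Π_j Finf_j(±y + a_j)` whose torus version is the same
expression in image sums of (5.10)-decaying `ℤ^d` kernels (explicit constants) inherits an EXPLICIT volume rate, hence the explicit
second-moment error of `Beta/InfiniteVolumeRate.lean` and the (AF-0s) list from certified torus values.  WHAT REMAINS LOCATED AND
UNPRINTED is unchanged (GAPS G-pv04-7 (i)): that Bałaban's `Π⁰_{k+1}` on `T` IS such an expression in image sums of `ℤ^d`
propagator kernels with explicit (5.10) constants — a statement about his construction, asserted nowhere here.

ABSOLUTE RULE.  No internally-minted statement enters as a cited fact: there are no cited facts in this file; `ScalarVolumeRate`,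
`VolumeRate`, `IsImageSum`, `Decay510` are `Prop`s used only to the LEFT of `→`.  Companion prose:
`run/shared/lean/pub/pub-balaban/b2b-balaban-pv04/VOLUME-IMAGES.md` §5; GAPS rows C-pv04-12 / G-pv04-7.
-/

namespace Literature.MathematicalPhysics.QuantumFieldTheory.Balaban1983to89.Beta

open Literature.MathematicalPhysics.QuantumFieldTheory.Balaban1983to89
open Literature.MathematicalPhysics.QuantumFieldTheory.Balaban1983to89.B12Sec2to5 (l1 l1_nonneg abs_coord_le_l1 Decay510)
open _root_.Filter
open scoped _root_.Topology

/-! ## §1. Re-anchoring geometry -/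

section Geometry

variable {d : ℕ}

/-- `siteOf` is additive. [folklore] -/
theorem siteOf_add (s : ℕ) (y z : Fin d → ℤ) : siteOf d s (y + z) = siteOf d s y + siteOf d s z := by
  funext i; simp [siteOf, Int.cast_add]

/-- `siteOf` is odd. [folklore] -/
theorem siteOf_neg (s : ℕ) (y : Fin d → ℤ) : siteOf d s (-y) = -siteOf d s y := by
  funext i; simp [siteOf, Int.cast_neg]

/-- ONE COORDINATE OF RE-ANCHORING: if `2|w| ≤ s` and `w + a = r + s·m`, then `|w| − |a| ≤ |r|` (for `m = 0` the triangle
inequality; for `m ≠ 0`, `|r| ≥ s|m| − |w + a| ≥ s − |w| − |a| ≥ |w| − |a|`). [folklore] -/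
theorem abs_sub_abs_le_abs_rep {s : ℕ} {w a r m : ℤ} (hw : 2 * |w| ≤ s) (h : w + a = r + s * m) :
    |w| - |a| ≤ |r| := by
  by_cases hm : m = 0
  · subst hm
    have h' : r = w + a := by linarith
    rw [h']
    have := abs_sub_abs_le_abs_sub (w + a) a
    simp only [add_sub_cancel_right] at this
    linarith [abs_sub_comm (w + a) a, abs_sub_abs_le_abs_sub w (-a), abs_neg a,
      show |w| - |a| ≤ |w + a| from by
        have h1 := abs_add_le (w + a) (-a); simp only [add_neg_cancel_right, abs_neg] at h1; linarith]
  · have hm1 : (1 : ℤ) ≤ |m| := Int.one_le_abs hm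
    have hs0 : (0 : ℤ) ≤ s := Int.natCast_nonneg s
    have h1 : (s : ℤ) ≤ |(s : ℤ) * m| := by
      rw [abs_mul, abs_of_nonneg hs0]; nlinarith
    have h2 : |(s : ℤ) * m| ≤ |r| + |w + a| := by
      have e : (s : ℤ) * m = (w + a) - r := by linarith
      rw [e]
      have := abs_sub_le (w + a) 0 r
      simp only [sub_zero, zero_sub, abs_neg] at this
      linarith
    have h3 : |w + a| ≤ |w| + |a| := abs_add_le w a
    linarith

/-- OFF-WINDOW SMALLNESS, ONE COORDINATE: if moreover `w + a` is off the window and `r` is on it, then `m ≠ 0` and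
`s − 2|a| ≤ 2|r|`. [folklore] -/
theorem sub_two_mul_abs_le_two_mul_abs_rep {s : ℕ} {w a r m : ℤ} (hw : 2 * |w| ≤ s) (hv : ¬ InWindow s (w + a))
    (hr : InWindow s r) (h : w + a = r + s * m) : (s : ℤ) - 2 * |a| ≤ 2 * |r| := by
  have hm : m ≠ 0 := by
    rintro rfl
    have h' : w + a = r := by simpa using h
    exact hv (h' ▸ hr)
  have hm1 : (1 : ℤ) ≤ |m| := Int.one_le_abs hm
  have hs0 : (0 : ℤ) ≤ s := Int.natCast_nonneg s
  have h1 : (s : ℤ) ≤ |(s : ℤ) * m| := by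
    rw [abs_mul, abs_of_nonneg hs0]; nlinarith
  have h2 : |(s : ℤ) * m| ≤ |r| + |w + a| := by
    have e : (s : ℤ) * m = (w + a) - r := by linarith
    rw [e]
    have := abs_sub_le (w + a) 0 r
    simp only [sub_zero, zero_sub, abs_neg] at this
    linarith
  have h3 : |w + a| ≤ |w| + |a| := abs_add_le w a
  linarith

variable {s : ℕ} [NeZero s]

/-- The window coordinates satisfy `2|w_i| ≤ s`. [folklore] -/
theorem two_mul_abs_windowMap_le (x : Site d s) (i : Fin d) : 2 * |windowMap d s x i| ≤ s :=
  two_mul_abs_symmRep_le s (x i)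

/-- RE-ANCHORING, `ℓ¹` FORM: for a reference point `w` with `2|w_i| ≤ s` and a shift `a`, the window representative `r` of the
class of `w + a` satisfies `|w|₁ − |a|₁ ≤ |r|₁`. [folklore] -/
theorem l1_sub_l1_le_l1_windowMap {w a : Fin d → ℤ} {x' : Site d s} (hw : ∀ i, 2 * |w i| ≤ s)
    (hv : siteOf d s (w + a) = x') : l1 w - l1 a ≤ l1 (windowMap d s x') := by
  obtain ⟨m, hm⟩ := exists_eq_imageShift_of_siteOf_eq hv
  unfold l1
  rw [← Finset.sum_sub_distrib]
  refine Finset.sum_le_sum fun i _ => ?_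
  have hi : w i + a i = windowMap d s x' i + (s : ℤ) * m i := by
    have := congrFun hm i
    simpa [imageShift] using this
  have key := abs_sub_abs_le_abs_rep (hw i) hi
  have key' : (|w i| : ℝ) - |(a i : ℝ)| ≤ |(windowMap d s x' i : ℝ)| := by exact_mod_cast key
  simpa [Int.cast_abs] using key'

/-- OFF-WINDOW SMALLNESS, `ℓ¹` FORM: if `w + a` is off the window cube then its window representative `r` satisfies
`s/2 − |a|₁ ≤ |r|₁`. [folklore] -/
theorem half_side_sub_l1_le_l1_windowMap {w a : Fin d → ℤ} {x' : Site d s} (hw : ∀ i, 2 * |w i| ≤ s)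
    (hv : siteOf d s (w + a) = x') (hoff : ¬ ∀ i, InWindow s ((w + a) i)) :
    (s : ℝ) / 2 - l1 a ≤ l1 (windowMap d s x') := by
  obtain ⟨m, hm⟩ := exists_eq_imageShift_of_siteOf_eq hv
  obtain ⟨i, hi⟩ : ∃ i, ¬ InWindow s ((w + a) i) := not_forall.mp hoff
  have hi' : w i + a i = windowMap d s x' i + (s : ℤ) * m i := by
    have := congrFun hm i
    simpa [imageShift] using this
  have key := sub_two_mul_abs_le_two_mul_abs_rep (hw i) (by simpa using hi) (inWindow_windowMap x' i) hi'
  have key' : (s : ℝ) - 2 * |(a i : ℝ)| ≤ 2 * |(windowMap d s x' i : ℝ)| := by exact_mod_cast key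
  have h1 : |(a i : ℝ)| ≤ l1 a := abs_coord_le_l1 a i
  have h2 : |(windowMap d s x' i : ℝ)| ≤ l1 (windowMap d s x') := abs_coord_le_l1 _ i
  linarith

/-- ON THE WINDOW nothing moves: if `w + a` is on the window cube, its window representative is `w + a`. [folklore] -/
theorem windowMap_eq_of_inWindow {w a : Fin d → ℤ} {x' : Site d s} (hv : siteOf d s (w + a) = x')
    (hon : ∀ i, InWindow s ((w + a) i)) : windowMap d s x' = w + a := by
  rw [← hv, windowMap_siteOf d s hon]

/-- Triangle inequality in the form used below: `|w|₁ ≤ |w + a|₁ + |a|₁`. [folklore] -/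
theorem l1_le_l1_add_add_l1 (w a : Fin d → ℤ) : l1 w ≤ l1 (w + a) + l1 a := by
  unfold l1
  rw [← Finset.sum_add_distrib]
  refine Finset.sum_le_sum fun i _ => ?_
  have h := abs_add_le ((w i : ℝ) + (a i : ℝ)) (-(a i : ℝ))
  simp only [add_neg_cancel_right, abs_neg] at h
  simpa [Pi.add_apply, Int.cast_add] using h

end Geometry

/-! ## §2. The re-anchoring estimate -/

section Reanchor

variable {d : ℕ} {side : ℕ → ℕ} [∀ t, NeZero (side t)]
  {F : (t : ℕ) → Site d (side t) → ℝ} {Finf : (Fin d → ℤ) → ℝ} {ρ : ℕ → ℝ} {δ C δ₁ δ' : ℝ}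

/-- An exponential bookkeeping step: from `L − A ≤ R`, `0 ≤ L`, `δ′ ≤ δ`, `0 ≤ δ`:
`e^{−δR} ≤ e^{δA}·e^{−δ′L}`. [folklore] -/
theorem exp_weight_le {L A R δ δ' : ℝ} (hR : L - A ≤ R) (hL : 0 ≤ L) (hδ : 0 ≤ δ) (hδ' : δ' ≤ δ) :
    Real.exp (-δ * R) ≤ Real.exp (δ * A) * Real.exp (-δ' * L) := by
  rw [← Real.exp_add, Real.exp_le_exp]
  nlinarith [mul_le_mul_of_nonneg_left hR hδ, mul_le_mul_of_nonneg_right hδ' hL]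

/-- The off-window bookkeeping step: from `S/2 − A ≤ R`, `L − A ≤ R`, `0 ≤ L`, `0 ≤ δ₁`, `2δ′ ≤ δ₁`:
`e^{−δ₁R} ≤ e^{δ₁A}·e^{−δ₁S/4}·e^{−δ′L}`. [folklore] -/
theorem exp_weight_off_le {L A R S δ₁ δ' : ℝ} (hR₁ : S / 2 - A ≤ R) (hR₂ : L - A ≤ R) (hL : 0 ≤ L) (hδ₁ : 0 ≤ δ₁)
    (hδ' : 2 * δ' ≤ δ₁) :
    Real.exp (-δ₁ * R) ≤ Real.exp (δ₁ * A) * Real.exp (-δ₁ * S / 4) * Real.exp (-δ' * L) := by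
  rw [← Real.exp_add, ← Real.exp_add, Real.exp_le_exp]
  have h1 := mul_le_mul_of_nonneg_left hR₁ (by positivity : (0:ℝ) ≤ δ₁ / 2)
  have h2 := mul_le_mul_of_nonneg_left hR₂ (by positivity : (0:ℝ) ≤ δ₁ / 2)
  have h3 := mul_le_mul_of_nonneg_right hδ' hL
  nlinarith [h1, h2, h3]

/-- **THE RE-ANCHORING ESTIMATE.**  Under a volume rate for `(F, Finf)` with exponent `δ ≥ 0` and (5.10)-decay of `Finf`
with `(C, δ₁)`, `δ₁ ≥ 0`: for every exponent `δ′` with `δ′ ≤ δ` and `2δ′ ≤ δ₁`, every reference point `w` with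
`2|w_i| ≤ side t`, and every shift `a`, at the torus point `x'` of `w + a`:
`|F t x' − Finf (w + a)| ≤ (ρ t·e^{δ|a|₁} + 2C·e^{δ₁|a|₁}·e^{−δ₁·side t/4})·e^{−δ′|w|₁}`.
(On the window `Finf` is evaluated at the representative and only the rate term appears; off the window both `Finf (w + a)` and
`Finf (windowMap x')` are `O(C e^{−δ₁ s/4})` by §1.) [folklore] -/
theorem ScalarVolumeRate.reanchor (h : ScalarVolumeRate side F Finf ρ δ) (hδ : 0 ≤ δ) (hinf : Decay510 Finf C δ₁)
    (hδ₁ : 0 ≤ δ₁) (hδ'δ : δ' ≤ δ) (hδ'1 : 2 * δ' ≤ δ₁) (t : ℕ) {x' : Site d (side t)}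
    {w a : Fin d → ℤ} (hw : ∀ i, 2 * |w i| ≤ side t) (hv : siteOf d (side t) (w + a) = x') :
    |F t x' - Finf (w + a)| ≤
      (ρ t * Real.exp (δ * l1 a) + 2 * C * Real.exp (δ₁ * l1 a) * Real.exp (-δ₁ * side t / 4)) *
        Real.exp (-δ' * l1 w) := by
  have hC : 0 ≤ C := decay510_constant_nonneg hinf
  have hρ : 0 ≤ ρ t := h.nonneg t
  have hLw : 0 ≤ l1 w := l1_nonneg w
  have hr1 : l1 w - l1 a ≤ l1 (windowMap d (side t) x') := l1_sub_l1_le_l1_windowMap hw hv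
  have hrate := h t x'
  -- the rate term
  have hA : ρ t * Real.exp (-δ * l1 (windowMap d (side t) x')) ≤ ρ t * Real.exp (δ * l1 a) * Real.exp (-δ' * l1 w) := by
    rw [mul_assoc]
    exact mul_le_mul_of_nonneg_left (exp_weight_le hr1 hLw hδ hδ'δ) hρ
  have hBnonneg : 0 ≤ 2 * C * Real.exp (δ₁ * l1 a) * Real.exp (-δ₁ * side t / 4) * Real.exp (-δ' * l1 w) := by
    positivity
  by_cases hon : ∀ i, InWindow (side t) ((w + a) i)
  · -- on the window: the representative IS `w + a`
    rw [windowMap_eq_of_inWindow hv hon] at hrate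
    calc |F t x' - Finf (w + a)| ≤ ρ t * Real.exp (-δ * l1 (w + a)) := hrate
      _ ≤ ρ t * Real.exp (δ * l1 a) * Real.exp (-δ' * l1 w) := by
          rw [windowMap_eq_of_inWindow hv hon] at hr1
          rw [mul_assoc]
          exact mul_le_mul_of_nonneg_left (exp_weight_le hr1 hLw hδ hδ'δ) hρ
      _ ≤ _ := by nlinarith [hBnonneg]
  · -- off the window: both limit values are exponentially small in the side
    have hr2 : (side t : ℝ) / 2 - l1 a ≤ l1 (windowMap d (side t) x') := half_side_sub_l1_le_l1_windowMap hw hv hon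
    have hv1 : (side t : ℝ) / 2 ≤ l1 (w + a) := half_side_le_l1_of_not_window hon
    have hv2 : l1 w - l1 a ≤ l1 (w + a) := by linarith [l1_le_l1_add_add_l1 w a]
    have hB1 : |Finf (windowMap d (side t) x')| ≤
        C * (Real.exp (δ₁ * l1 a) * Real.exp (-δ₁ * side t / 4) * Real.exp (-δ' * l1 w)) :=
      (hinf _).trans (mul_le_mul_of_nonneg_left (exp_weight_off_le hr2 hr1 hLw hδ₁ hδ'1) hC)
    have hB2 : |Finf (w + a)| ≤ C * (Real.exp (δ₁ * l1 a) * Real.exp (-δ₁ * side t / 4) * Real.exp (-δ' * l1 w)) :=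
      (hinf _).trans (mul_le_mul_of_nonneg_left (exp_weight_off_le (by linarith [l1_nonneg a]) hv2 hLw hδ₁ hδ'1) hC)
    have htri : |F t x' - Finf (w + a)| ≤
        |F t x' - Finf (windowMap d (side t) x')| + |Finf (windowMap d (side t) x')| + |Finf (w + a)| := by
      have e : F t x' - Finf (w + a) =
          (F t x' - Finf (windowMap d (side t) x')) + Finf (windowMap d (side t) x') + (-Finf (w + a)) := by ring
      rw [e]
      refine (abs_add_le _ _).trans ?_
      rw [abs_neg]
      exact add_le_add (abs_add_le _ _) le_rfl
    calc |F t x' - Finf (w + a)|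
        ≤ |F t x' - Finf (windowMap d (side t) x')| + |Finf (windowMap d (side t) x')| + |Finf (w + a)| := htri
      _ ≤ ρ t * Real.exp (δ * l1 a) * Real.exp (-δ' * l1 w) +
            C * (Real.exp (δ₁ * l1 a) * Real.exp (-δ₁ * side t / 4) * Real.exp (-δ' * l1 w)) +
            C * (Real.exp (δ₁ * l1 a) * Real.exp (-δ₁ * side t / 4) * Real.exp (-δ' * l1 w)) :=
          add_le_add (add_le_add (hrate.trans hA) hB1) hB2
      _ = _ := by ring

end Reanchor

/-! ## §3. Closure of volume rates, (5.10)-decay and image sums under translations and the reflection -/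

section Closure

variable {d : ℕ} {side : ℕ → ℕ} [∀ t, NeZero (side t)]
  {F : (t : ℕ) → Site d (side t) → ℝ} {Finf : (Fin d → ℤ) → ℝ} {ρ : ℕ → ℝ} {δ C δ₁ δ' : ℝ}

/-- **TRANSLATION CLOSURE.**  If `F t → Finf` at rate `ρ` (exponent `δ ≥ 0`) and `Finf` is `(C, δ₁)`-decaying (`δ₁ ≥ 0`),
then for every lattice vector `a` the translated torus functions `x ↦ F t (x + siteOf a)` converge to `y ↦ Finf (y + a)` at rate
`ρ t·e^{δ|a|₁} + 2C·e^{δ₁|a|₁}·e^{−δ₁·side t/4}` with any exponent `δ′ ≤ δ`, `2δ′ ≤ δ₁`. [folklore] -/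
theorem ScalarVolumeRate.translate (h : ScalarVolumeRate side F Finf ρ δ) (hδ : 0 ≤ δ) (hinf : Decay510 Finf C δ₁)
    (hδ₁ : 0 ≤ δ₁) (hδ'δ : δ' ≤ δ) (hδ'1 : 2 * δ' ≤ δ₁) (a : Fin d → ℤ) :
    ScalarVolumeRate side (fun t x => F t (x + siteOf d (side t) a)) (fun y => Finf (y + a))
      (fun t => ρ t * Real.exp (δ * l1 a) + 2 * C * Real.exp (δ₁ * l1 a) * Real.exp (-δ₁ * side t / 4)) δ' := by
  intro t x
  have hv : siteOf d (side t) (windowMap d (side t) x + a) = x + siteOf d (side t) a := by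
    rw [siteOf_add, siteOf_windowMap]
  exact h.reanchor hδ hinf hδ₁ hδ'δ hδ'1 t (two_mul_abs_windowMap_le x) hv

/-- **REFLECTION CLOSURE.**  Same hypotheses: the reflected torus functions `x ↦ F t (−x)` converge to `y ↦ Finf (−y)` at rate
`ρ t + 2C·e^{−δ₁·side t/4}` with any exponent `δ′ ≤ δ`, `2δ′ ≤ δ₁` (the reference point is `−windowMap x`, which has
`2|w_i| ≤ s` but may leave the half-open window on the faces `w_i = s/2`). [folklore] -/
theorem ScalarVolumeRate.reflect (h : ScalarVolumeRate side F Finf ρ δ) (hδ : 0 ≤ δ) (hinf : Decay510 Finf C δ₁)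
    (hδ₁ : 0 ≤ δ₁) (hδ'δ : δ' ≤ δ) (hδ'1 : 2 * δ' ≤ δ₁) :
    ScalarVolumeRate side (fun t x => F t (-x)) (fun y => Finf (-y))
      (fun t => ρ t + 2 * C * Real.exp (-δ₁ * side t / 4)) δ' := by
  intro t x
  show |F t (-x) - Finf (-windowMap d (side t) x)| ≤
    (ρ t + 2 * C * Real.exp (-δ₁ * side t / 4)) * Real.exp (-δ' * l1 (windowMap d (side t) x))
  have hw : ∀ i, 2 * |(-windowMap d (side t) x) i| ≤ side t := fun i => by
    simpa [abs_neg] using two_mul_abs_windowMap_le x i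
  have hv : siteOf d (side t) (-windowMap d (side t) x + 0) = -x := by
    rw [add_zero, siteOf_neg, siteOf_windowMap]
  have key := h.reanchor hδ hinf hδ₁ hδ'δ hδ'1 t hw hv
  have e0 : l1 (0 : Fin d → ℤ) = 0 := by simp [l1]
  have e1 : l1 (-windowMap d (side t) x) = l1 (windowMap d (side t) x) := by simp [l1, abs_neg]
  simpa [e0, e1] using key

variable {P : (t : ℕ) → Fin d → Fin d → Site d (side t) → ℝ} {Pinf : B12Beta.Kernel d}

/-- `μν`-indexed translation closure (`VolumeRate`). [folklore] -/
theorem VolumeRate.translate (h : VolumeRate side P Pinf ρ δ) (hδ : 0 ≤ δ) (hinf : ∀ μ ν, Decay510 (Pinf μ ν) C δ₁)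
    (hδ₁ : 0 ≤ δ₁) (hδ'δ : δ' ≤ δ) (hδ'1 : 2 * δ' ≤ δ₁) (a : Fin d → ℤ) :
    VolumeRate side (fun t μ ν x => P t μ ν (x + siteOf d (side t) a)) (fun μ ν y => Pinf μ ν (y + a))
      (fun t => ρ t * Real.exp (δ * l1 a) + 2 * C * Real.exp (δ₁ * l1 a) * Real.exp (-δ₁ * side t / 4)) δ' :=
  volumeRate_iff_scalar.mpr fun μ ν =>
    (volumeRate_iff_scalar.mp h μ ν).translate hδ (hinf μ ν) hδ₁ hδ'δ hδ'1 a

/-- `μν`-indexed reflection closure (`VolumeRate`). [folklore] -/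
theorem VolumeRate.reflect (h : VolumeRate side P Pinf ρ δ) (hδ : 0 ≤ δ) (hinf : ∀ μ ν, Decay510 (Pinf μ ν) C δ₁)
    (hδ₁ : 0 ≤ δ₁) (hδ'δ : δ' ≤ δ) (hδ'1 : 2 * δ' ≤ δ₁) :
    VolumeRate side (fun t μ ν x => P t μ ν (-x)) (fun μ ν y => Pinf μ ν (-y))
      (fun t => ρ t + 2 * C * Real.exp (-δ₁ * side t / 4)) δ' :=
  volumeRate_iff_scalar.mpr fun μ ν => (volumeRate_iff_scalar.mp h μ ν).reflect hδ (hinf μ ν) hδ₁ hδ'δ hδ'1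

/-- (5.10)-decay under translation: constant `C·e^{δ₁|a|₁}`, same rate (`|y + a|₁ ≥ |y|₁ − |a|₁`). [folklore] -/
theorem decay510_translate {K : (Fin d → ℤ) → ℝ} {C δ₁ : ℝ} (h : Decay510 K C δ₁) (hδ₁ : 0 ≤ δ₁) (a : Fin d → ℤ) :
    Decay510 (fun y => K (y + a)) (C * Real.exp (δ₁ * l1 a)) δ₁ := by
  intro y
  have hC : 0 ≤ C := decay510_constant_nonneg h
  have h1 : l1 y - l1 a ≤ l1 (y + a) := by linarith [l1_le_l1_add_add_l1 y a]
  calc |K (y + a)| ≤ C * Real.exp (-δ₁ * l1 (y + a)) := h (y + a)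
    _ ≤ C * (Real.exp (δ₁ * l1 a) * Real.exp (-δ₁ * l1 y)) :=
        mul_le_mul_of_nonneg_left (exp_weight_le h1 (l1_nonneg y) hδ₁ le_rfl) hC
    _ = _ := by ring

/-- (5.10)-decay under the reflection: unchanged (`|−y|₁ = |y|₁`). [folklore] -/
theorem decay510_reflect {K : (Fin d → ℤ) → ℝ} {C δ₁ : ℝ} (h : Decay510 K C δ₁) : Decay510 (fun y => K (-y)) C δ₁ := by
  intro y
  have e1 : l1 (-y) = l1 y := by simp [l1, abs_neg]
  simpa [e1] using h (-y)

/-- **IMAGE SUMS TRANSLATE EXACTLY**: if `F t` is the image sum of `Finf`, then `x ↦ F t (x + siteOf a)` is the image sum of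
`y ↦ Finf (y + a)` (the images of `windowMap x` shifted by `a` are the images of the lift `windowMap x + a` of `x + siteOf a`;
representative independence). No boundary loss at this level. [folklore] -/
theorem IsImageSum.translate (h : IsImageSum side F Finf) (a : Fin d → ℤ) :
    IsImageSum side (fun t x => F t (x + siteOf d (side t) a)) (fun y => Finf (y + a)) := by
  intro t x
  have hv : siteOf d (side t) (windowMap d (side t) x + a) = x + siteOf d (side t) a := by
    rw [siteOf_add, siteOf_windowMap]
  have key := (hasSum_imageShift_iff_of_siteOf_eq Finf hv (F t (x + siteOf d (side t) a))).mpr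
    (h t (x + siteOf d (side t) a))
  have e : (fun n : Fin d → ℤ => Finf (imageShift (side t) (windowMap d (side t) x) n + a)) =
      fun n => Finf (imageShift (side t) (windowMap d (side t) x + a) n) := by
    funext n; congr 1; funext i; simp [imageShift]; ring
  show HasSum (fun n : Fin d → ℤ => Finf (imageShift (side t) (windowMap d (side t) x) n + a))
    (F t (x + siteOf d (side t) a))
  rw [e]; exact key

/-- **IMAGE SUMS REFLECT EXACTLY**: if `F t` is the image sum of `Finf`, then `x ↦ F t (−x)` is the image sum of `y ↦ Finf (−y)`
(`−(w + s·n) = (−w) + s·(−n)`, re-index by `n ↦ −n`, and `−windowMap x` is a lift of `−x`). [folklore] -/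
theorem IsImageSum.reflect (h : IsImageSum side F Finf) :
    IsImageSum side (fun t x => F t (-x)) (fun y => Finf (-y)) := by
  intro t x
  have hv : siteOf d (side t) (-windowMap d (side t) x) = -x := by rw [siteOf_neg, siteOf_windowMap]
  have key := (hasSum_imageShift_iff_of_siteOf_eq Finf hv (F t (-x))).mpr (h t (-x))
  have e : (fun n : Fin d → ℤ => Finf (-imageShift (side t) (windowMap d (side t) x) n)) =
      (fun n => Finf (imageShift (side t) (-windowMap d (side t) x) n)) ∘ (Equiv.neg (Fin d → ℤ)) := by
    funext n
    simp only [Function.comp_apply, Equiv.neg_apply]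
    congr 1; funext i; simp [imageShift]; ring
  show HasSum (fun n : Fin d → ℤ => Finf (-imageShift (side t) (windowMap d (side t) x) n)) (F t (-x))
  rw [e, Equiv.hasSum_iff]; exact key

end Closure

/-! ## §4. The bubble shape: translate, reflect, multiply -/

section Bubble

variable {d : ℕ} {side : ℕ → ℕ} [∀ t, NeZero (side t)]
  {F₁ F₂ : (t : ℕ) → Site d (side t) → ℝ} {Finf₁ Finf₂ : (Fin d → ℤ) → ℝ} {ρ₁ ρ₂ : ℕ → ℝ} {δ C₁ C₂ δ₁ δ' : ℝ}

/-- **THE BUBBLE TERM.**  Two torus families with volume rates `ρ₁, ρ₂` (common exponent `δ ≥ 0`) and `(C₁, δ₁)`-,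
`(C₂, δ₁)`-decaying limits (`δ₁ ≥ 0`), an exponent `δ′ ≥ 0` with `δ′ ≤ δ`, `2δ′ ≤ δ₁`, and lattice vectors `a, b`: the composite
`x ↦ F₁ t (x + siteOf a) · F₂ t (−x + siteOf b)` converges to `y ↦ Finf₁ (y + a) · Finf₂ (−y + b)` at the explicit rate
`ρ₁′(C₂′ + ρ₂′) + C₁′ρ₂′` with `ρ₁′ = ρ₁e^{δ|a|₁} + 2C₁e^{δ₁|a|₁}e^{−δ₁s/4}`, `C₁′ = C₁e^{δ₁|a|₁}`,
`ρ₂′ = ρ₂e^{δ|b|₁} + 2C₂e^{δ₁|b|₁}e^{−δ₁s/4} + 2C₂e^{δ₁|b|₁}e^{−δ₁s/4}`, `C₂′ = C₂e^{δ₁|b|₁}` (translate; translate then reflect;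
multiply).  This is the shape of the propagator-bilinear term of a one-loop kernel with local vertices. [folklore] -/
theorem ScalarVolumeRate.bubbleTerm (h₁ : ScalarVolumeRate side F₁ Finf₁ ρ₁ δ) (h₂ : ScalarVolumeRate side F₂ Finf₂ ρ₂ δ)
    (hδ : 0 ≤ δ) (hinf₁ : Decay510 Finf₁ C₁ δ₁) (hinf₂ : Decay510 Finf₂ C₂ δ₁) (hδ₁ : 0 ≤ δ₁) (hδ'0 : 0 ≤ δ')
    (hδ'δ : δ' ≤ δ) (hδ'1 : 2 * δ' ≤ δ₁) (a b : Fin d → ℤ) :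
    ScalarVolumeRate side
      (fun t x => F₁ t (x + siteOf d (side t) a) * F₂ t (-x + siteOf d (side t) b))
      (fun y => Finf₁ (y + a) * Finf₂ (-y + b))
      (fun t =>
        (ρ₁ t * Real.exp (δ * l1 a) + 2 * C₁ * Real.exp (δ₁ * l1 a) * Real.exp (-δ₁ * side t / 4)) *
            (C₂ * Real.exp (δ₁ * l1 b) +
              ((ρ₂ t * Real.exp (δ * l1 b) + 2 * C₂ * Real.exp (δ₁ * l1 b) * Real.exp (-δ₁ * side t / 4)) +
                2 * (C₂ * Real.exp (δ₁ * l1 b)) * Real.exp (-δ₁ * side t / 4))) +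
          C₁ * Real.exp (δ₁ * l1 a) *
            ((ρ₂ t * Real.exp (δ * l1 b) + 2 * C₂ * Real.exp (δ₁ * l1 b) * Real.exp (-δ₁ * side t / 4)) +
              2 * (C₂ * Real.exp (δ₁ * l1 b)) * Real.exp (-δ₁ * side t / 4)))
      δ' := by
  -- translate both factors (exponent δ′), reflect the second (exponent δ′ again: δ′ ≤ δ′, 2δ′ ≤ δ₁), multiply
  have t₁ := h₁.translate hδ hinf₁ hδ₁ hδ'δ hδ'1 a
  have t₂ := h₂.translate hδ hinf₂ hδ₁ hδ'δ hδ'1 b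
  have d₁ := decay510_translate hinf₁ hδ₁ a
  have d₂ := decay510_translate hinf₂ hδ₁ b
  have r₂ := t₂.reflect hδ'0 d₂ hδ₁ le_rfl hδ'1
  have d₂' := decay510_reflect d₂
  have m := t₁.mul r₂ hδ'0 d₁ hδ₁ d₂' hδ₁
  intro t x
  have key := m t x
  simpa only [neg_add_rev, add_comm, sub_eq_add_neg] using key

end Bubble

end Literature.MathematicalPhysics.QuantumFieldTheory.Balaban1983to89.Beta
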